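import Summits.QuantumFields.BalabanUV.T4Continuum.Support.ReplicationRightInverse

/-!
# ReplicationRightInverseBound (T⁴ programme, node NE3, crew row S6-Y7 (c) `replicationRightInverse`, file 6/6) — THE BOUND OF
# THE ITERATED RIGHT INVERSE AND ITS UNIFORMITY IN THE NUMBER OF LEVELS: `‖liftIter L j W x φ (z,i)‖ ≤ liftConst j x·‖φ(⌊z/L^{j+1}⌋,i)‖`,
# `liftConst j x = Π_levels (1 + 128dL²·radius) ≤ 2` for `L ≥ 2` under `LevelSmall d L j x` — B7's «`|Q_k(U₀; c, b)| ≤ 1 + 2C′₁α₀`»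
# mirrored for the inverse

HONEST FRAMING (cell `pub-balaban`, T4-DAG PAGE 1; unit `b2b-balaban-t4-ne3-formalise-leaf-01` gen 3, NE3 (node U1b)
formalisation swarm, crew sub-row **S6-Y7 (c)** of `t4/formal/NE3/LEAVES.md` = leaf **L7(c) `replicationRightInverse`** of
the road-P3 skeleton `t4/skeletons/NE3-t4-ne3-p3.md` §2: «‖Q_R‖ sup→sup ≤ C_R» with C_R uniform in the number of levels).
The cell's T4 target is the finite-torus continuum limit of the unit-scale averaged loop expectations — NOT infinite volume, NO
mass gap, NOT Clay, NOT summit progress.  All [folklore], 0 sorry: §1 `liftConst`, `cdivIter`, **`norm_liftIter_le`** (pointwise,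
product of the one-level constants of file 4's `norm_spreadInverse_le`); §2 the radii grow GEOMETRICALLY up the tower for `L ≥ 2`
(`prop1Radius x ≥ L²x ≥ 4x`): `radSum ≤ (4/3)·radIter − x/3`, the top radius obeys `twoLevelSmall·radIter ≤ 1`
(`twoLevelSmall_radIter`), hence `liftConst ≤ 1 + 256dL²·radSum ≤ 1 + 1/64 ≤ 2` (**`liftConst_le_two`**) and the `j`-UNIFORM
bounds **`norm_liftIter_le_two`** ∕ `norm_liftIter_le_of_sup` (sup → sup with constant 2); §3 the period sums down the tower
**`dirL1_liftIter_le`** ∕ **`dirSq_liftIter_le`** with the EXACT volume factor `(L^{d−1})^{j+1}`.  CURRENCY NOTE (honest): the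
pointwise∕sup bound is uniform in `j`; counting `ℓ¹`∕`ℓ²` sums carry the volume factor `L^{(d−1)}` PER LEVEL, uniform only after
volume weighting (`× L^{−(d−1)}` per level = the natural `η^{d−1}`-weight of unit-lattice sums read on the fine lattice).  NOT NE3 in disguise: real-number bookkeeping of the averaging
radii at one background tower; no minimiser, no two-spacing comparison, no rate.  NE3 is NOT proved by this file.
CITATION HEADER: no printed sentence is a hypothesis; the manuscripts under audit are not cited for any disputed step;
context: T. Bałaban, Commun. Math. Phys. **98** (1985) 17–51 [Balaban1985Averaging] (Prop. 1 p. 24, (139)–(147) p. 39–40).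
PLACEMENT: `Summits/QuantumFields/BalabanUV/` (human rule 2026-08-19).  Record: HOME `t4/formal/NE3/LEAVES.md` row S5∕S6.
-/

set_option autoImplicit false

open scoped BigOperators Matrix Matrix.Norms.L2Operator Topology
open NormedSpace Finset Filter

namespace Summit.QuantumFields.BalabanUV.T4Continuum.ReplicationRightInverseBound

open Literature.MathematicalPhysics.QuantumFieldTheory.Balaban1983to89
open B7Prop1Explicit B7Prop2Explicit MatrixLog UnitaryModel
open T4AveragingDeficitWall hiding Site Plane Plaq Bond
open T4AveragingDeficitWallBoundary (periodBox)
open AveragingDeficitChartCalculus (cavg)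
open AveragingDeficitTwoLevelPrep (twoLevelSmall prop1Radius)
open AveragingDeficitMultiLevelPrep (LevelSmall radIter prop1Radius_nonneg tower)
open SkeletonLattice (cdiv)
open SpreadLiftWords SpreadLiftDirection SpreadLiftMap SpreadLift ReplicationRightInverse

noncomputable section

variable {d : ℕ} {n : Type*} [Fintype n] [DecidableEq n]

section Bound

variable [Nonempty n] {L : ℕ}

/-! ## §1 The pointwise bound -/

/-- The product of the one-level constants down the tower: `liftConst 0 x = 1 + 128dL²x`,
`liftConst (j+1) x = (1 + 128dL²x)·liftConst j (prop1Radius x)`. [folklore] -/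
def liftConst (d L : ℕ) : ℕ → ℝ → ℝ
  | 0, x => 1 + 128 * (d * (L : ℝ) ^ 2 * x)
  | j + 1, x => (1 + 128 * (d * (L : ℝ) ^ 2 * x)) * liftConst d L j (prop1Radius d L x)

/-- The coarse site of `z` after `j + 1` block steps: `cdivIter 0 = ⌊·/L⌋`, `cdivIter (j+1) z = cdivIter j ⌊z/L⌋`. [folklore] -/
def cdivIter (L : ℕ) : ℕ → Site d → Site d
  | 0, z => cdiv L z
  | j + 1, z => cdivIter L j (cdiv L z)

omit [Nonempty n] in
/-- `liftConst ≥ 1`. [folklore] -/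
theorem one_le_liftConst : ∀ (j : ℕ) {x : ℝ}, 0 ≤ x → 1 ≤ liftConst d L j x
  | 0, x, hx => by
      have h0 : 0 ≤ (d : ℝ) * (L : ℝ) ^ 2 * x := by positivity
      simp only [liftConst]
      linarith
  | j + 1, x, hx => by
      have h1 := one_le_liftConst j (prop1Radius_nonneg (d := d) (L := L) hx)
      have h0 : 0 ≤ (d : ℝ) * (L : ℝ) ^ 2 * x := by positivity
      simp only [liftConst]
      nlinarith

/-- **THE POINTWISE BOUND**: `‖liftIter L j W x φ (z, i)‖ ≤ liftConst j x · ‖φ(cdivIter j z, i)‖`. [cite: Balaban1985Averaging, (139)–(147) p.39–40] -/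
theorem norm_liftIter_le (hL : 1 ≤ L) (j : ℕ) : ∀ {W : Site d → Fin d → (Matrix n n ℂ)ˣ} {x : ℝ}, IsUnitaryCfg W → 0 ≤ x →
    LevelSmall d L j x → SmallField W x → ∀ (φ : Site d → Fin d → Matrix n n ℂ) (z : Site d) (i : Fin d),
    ‖liftIter L j W x φ z i‖ ≤ liftConst d L j x * ‖φ (cdivIter L j z) i‖ := by
  induction j with
  | zero =>
      intro W x hW hx hs hWx φ z i
      rw [liftIter_zero hL hW hx hs hWx]; exact norm_spreadInverse_le hL hW hx _ hWx φ z i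
  | succ j ih0 =>
      intro W x hW hx hs hWx φ z i
      obtain ⟨hW', hx', hs', hWx'⟩ := next_level hL hW hx hs hWx
      rw [liftIter_succ hL j hW hx hs hWx]
      refine (norm_spreadInverse_le hL hW hx _ hWx _ z i).trans ?_
      have ih := ih0 hW' hx' hs' hWx' φ (cdiv L z) i
      have h0 : 0 ≤ 1 + 128 * (d * (L : ℝ) ^ 2 * x) := by positivity
      calc (1 + 128 * (d * (L : ℝ) ^ 2 * x)) * ‖liftIter L j (cavg L W) (prop1Radius d L x) φ (cdiv L z) i‖
          ≤ (1 + 128 * (d * (L : ℝ) ^ 2 * x)) * (liftConst d L j (prop1Radius d L x) * ‖φ (cdivIter L j (cdiv L z)) i‖) :=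
            mul_le_mul_of_nonneg_left ih h0
        _ = liftConst d L (j + 1) x * ‖φ (cdivIter L (j + 1) z) i‖ := by
            simp only [liftConst, cdivIter]; ring

/-! ## §2 Uniformity in the number of levels (`L ≥ 2`) -/

/-- The sum of the radii down the tower: `radSum 0 x = x`, `radSum (j+1) x = x + radSum j (prop1Radius x)`. [folklore] -/
def radSum (d L : ℕ) : ℕ → ℝ → ℝ
  | 0, x => x
  | j + 1, x => x + radSum d L j (prop1Radius d L x)

omit [Nonempty n] in
/-- `radSum ≥ 0`. [folklore] -/
theorem radSum_nonneg : ∀ (j : ℕ) {x : ℝ}, 0 ≤ x → 0 ≤ radSum d L j x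
  | 0, _, hx => hx
  | j + 1, _, hx => add_nonneg hx (radSum_nonneg j (prop1Radius_nonneg hx))

omit [Nonempty n] in
/-- **GEOMETRIC GROWTH OF THE RADII** (`L ≥ 2`: `prop1Radius x ≥ L²x ≥ 4x`): the sum of the radii is at most `4/3` of the
top one, `radSum j x ≤ (4/3)·radIter j x − x/3`. [folklore] -/
theorem radSum_le (hL2 : 2 ≤ L) : ∀ (j : ℕ) {x : ℝ}, 0 ≤ x → radSum d L j x ≤ 4 / 3 * radIter d L j x - x / 3
  | 0, _, _ => by simp only [radSum, radIter]; linarith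
  | j + 1, x, hx => by
      simp only [radSum, radIter]
      have ih := radSum_le hL2 j (prop1Radius_nonneg (d := d) (L := L) hx)
      have hL4 : (4 : ℝ) ≤ (L : ℝ) ^ 2 := by
        have : (2 : ℝ) ≤ L := by exact_mod_cast hL2
        nlinarith
      have hp : 4 * x ≤ prop1Radius d L x := by
        unfold prop1Radius
        have h0 : 0 ≤ 226 * (8 * ((d : ℝ) + 1) * ((d : ℝ) + 4) * (L : ℝ) ^ 2 * x) ^ 2 := by positivity
        nlinarith
      linarith

omit [Nonempty n] in
/-- The top radius obeys the two-level smallness at every level of `LevelSmall`. [folklore] -/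
theorem twoLevelSmall_radIter : ∀ (j : ℕ) {x : ℝ}, LevelSmall d L j x → twoLevelSmall d L * radIter d L j x ≤ 1
  | 0, _, hs => hs
  | j + 1, _, hs => twoLevelSmall_radIter j hs.2

omit [Nonempty n] in
/-- **`liftConst ≤ 1 + 256dL²·radSum`** (products of `1 + ε_i` with `Σ ε_i ≤ 1/2`). [folklore] -/
theorem liftConst_le_radSum : ∀ (j : ℕ) {x : ℝ}, 0 ≤ x → 256 * (d * (L : ℝ) ^ 2 * radSum d L j x) ≤ 1 →
    liftConst d L j x ≤ 1 + 256 * (d * (L : ℝ) ^ 2 * radSum d L j x)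
  | 0, x, hx, _ => by
      have h0 : 0 ≤ (d : ℝ) * (L : ℝ) ^ 2 * x := by positivity
      simp only [liftConst, radSum]
      linarith
  | j + 1, x, hx, h => by
      simp only [liftConst, radSum] at h ⊢
      have hp0 := prop1Radius_nonneg (d := d) (L := L) hx
      have hS0 := radSum_nonneg (d := d) (L := L) j hp0
      have hdx : 0 ≤ (d : ℝ) * (L : ℝ) ^ 2 * x := by positivity
      have hdS : 0 ≤ (d : ℝ) * (L : ℝ) ^ 2 * radSum d L j (prop1Radius d L x) := by positivity
      have h' : 256 * (d * (L : ℝ) ^ 2 * radSum d L j (prop1Radius d L x)) ≤ 1 := by nlinarith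
      have ih := liftConst_le_radSum j hp0 h'
      have h1 := one_le_liftConst (d := d) (L := L) j hp0
      -- `(1 + a)(1 + 2b) ≤ 1 + 2(a + b)` for `2b ≤ 1`, with `a = 128θx`, `2b = 256θS`
      calc (1 + 128 * (d * (L : ℝ) ^ 2 * x)) * liftConst d L j (prop1Radius d L x)
          ≤ (1 + 128 * (d * (L : ℝ) ^ 2 * x)) * (1 + 256 * (d * (L : ℝ) ^ 2 * radSum d L j (prop1Radius d L x))) :=
            mul_le_mul_of_nonneg_left ih (by positivity)
        _ ≤ 1 + 256 * (d * (L : ℝ) ^ 2 * (x + radSum d L j (prop1Radius d L x))) := by nlinarith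

omit [Nonempty n] in
/-- **UNIFORMITY IN THE NUMBER OF LEVELS** (`L ≥ 2`): `liftConst j x ≤ 2` under `LevelSmall d L j x` (indeed `≤ 1 + 1/64`).
[folklore] -/
theorem liftConst_le_two (hL2 : 2 ≤ L) (j : ℕ) {x : ℝ} (hx : 0 ≤ x) (hs : LevelSmall d L j x) : liftConst d L j x ≤ 2 := by
  have hd0 : (0 : ℝ) ≤ d := Nat.cast_nonneg d
  have hL1 : (1 : ℝ) ≤ L := by exact_mod_cast (by omega : 1 ≤ L)
  have hLd : (1 : ℝ) ≤ (L : ℝ) ^ (d + 2) := one_le_pow₀ hL1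
  have htop := twoLevelSmall_radIter (d := d) (L := L) j hs
  have hsum := radSum_le (d := d) hL2 j hx
  have hR0 : 0 ≤ radIter d L j x := by
    have := radSum_nonneg (d := d) (L := L) j hx; linarith
  -- `256dL²·radSum ≤ 342dL²·radIter ≤ 342 d L² / (65536 (d+1)²(d+4)² L^{d+4}) ≤ 1/64`
  have hkey : 256 * (d * (L : ℝ) ^ 2 * radSum d L j x) ≤ 1 / 64 := by
    unfold AveragingDeficitTwoLevelPrep.twoLevelSmall at htop
    have hpow : (L : ℝ) ^ (d + 4) = (L : ℝ) ^ (d + 2) * (L : ℝ) ^ 2 := by ring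
    rw [hpow] at htop
    have hdl : 0 ≤ (d : ℝ) * (L : ℝ) ^ 2 := by positivity
    have h1 : 256 * (d * (L : ℝ) ^ 2 * radSum d L j x) ≤ 342 * (d * (L : ℝ) ^ 2 * radIter d L j x) := by
      have h1a : (d : ℝ) * (L : ℝ) ^ 2 * radSum d L j x ≤ (d : ℝ) * (L : ℝ) ^ 2 * (4 / 3 * radIter d L j x - x / 3) :=
        mul_le_mul_of_nonneg_left hsum hdl
      have h1b : 0 ≤ (d : ℝ) * (L : ℝ) ^ 2 * x := mul_nonneg hdl hx
      have h1c : 0 ≤ (d : ℝ) * (L : ℝ) ^ 2 * radIter d L j x := mul_nonneg hdl hR0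
      nlinarith
    have h2 : 64 * 342 * (d * (L : ℝ) ^ 2 * radIter d L j x)
        ≤ 65536 * ((d : ℝ) + 1) ^ 2 * ((d : ℝ) + 4) ^ 2 * ((L : ℝ) ^ (d + 2) * (L : ℝ) ^ 2) * radIter d L j x := by
      have h3 : (64 * 342 : ℝ) * d ≤ 65536 * ((d : ℝ) + 1) ^ 2 * ((d : ℝ) + 4) ^ 2 * (L : ℝ) ^ (d + 2) := by
        have : (d : ℝ) ≤ ((d : ℝ) + 1) ^ 2 * ((d : ℝ) + 4) ^ 2 := by nlinarith
        nlinarith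
      have h4 : 0 ≤ (L : ℝ) ^ 2 * radIter d L j x := by positivity
      nlinarith
    nlinarith
  have h := liftConst_le_radSum (d := d) (L := L) j hx (by linarith)
  linarith

/-- **THE `j`-UNIFORM POINTWISE BOUND** (`L ≥ 2`): `‖liftIter L j W x φ (z, i)‖ ≤ 2‖φ(cdivIter j z, i)‖`.
[cite: Balaban1985Averaging, (139)–(147) p.39–40] -/
theorem norm_liftIter_le_two (hL2 : 2 ≤ L) (j : ℕ) {W : Site d → Fin d → (Matrix n n ℂ)ˣ} {x : ℝ} (hW : IsUnitaryCfg W)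
    (hx : 0 ≤ x) (hs : LevelSmall d L j x) (hWx : SmallField W x) (φ : Site d → Fin d → Matrix n n ℂ) (z : Site d) (i : Fin d) :
    ‖liftIter L j W x φ z i‖ ≤ 2 * ‖φ (cdivIter L j z) i‖ :=
  (norm_liftIter_le (by omega) j hW hx hs hWx φ z i).trans
    (mul_le_mul_of_nonneg_right (liftConst_le_two hL2 j hx hs) (norm_nonneg _))

/-- **SUP → SUP, `j`-UNIFORM**: `sup_b ‖liftIter L j W x φ (b)‖ ≤ 2·sup_c ‖φ(c)‖` (`L ≥ 2`). [folklore] -/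
theorem norm_liftIter_le_of_sup (hL2 : 2 ≤ L) (j : ℕ) {W : Site d → Fin d → (Matrix n n ℂ)ˣ} {x : ℝ} (hW : IsUnitaryCfg W)
    (hx : 0 ≤ x) (hs : LevelSmall d L j x) (hWx : SmallField W x) {φ : Site d → Fin d → Matrix n n ℂ} {s : ℝ}
    (hφ : ∀ y κ, ‖φ y κ‖ ≤ s) (z : Site d) (i : Fin d) : ‖liftIter L j W x φ z i‖ ≤ 2 * s :=
  (norm_liftIter_le_two hL2 j hW hx hs hWx φ z i).trans (by linarith [hφ (cdivIter L j z) i])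

/-! ## §3 Period sums down the tower: the exact volume factor `L^{(d−1)(j+1)}` -/

/-- **`ℓ¹` OVER ONE PERIOD, ALL LEVELS**: `Σ_{z ∈ [0, L·L^j·M)^d, i} ‖liftIter L j W x φ (z,i)‖ ≤ liftConst j x · (L^{d−1})^{j+1} ·
Σ_{y ∈ [0,M)^d, i} ‖φ(y,i)‖` — the counting `ℓ¹` norm carries the volume factor `L^{d−1}` PER LEVEL (honest currency; `liftConst ≤ 2`
for `L ≥ 2` by `liftConst_le_two`). [folklore] -/
theorem dirL1_liftIter_le (hL : 1 ≤ L) (M : ℕ) (j : ℕ) : ∀ {W : Site d → Fin d → (Matrix n n ℂ)ˣ} {x : ℝ}, IsUnitaryCfg W →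
    0 ≤ x → LevelSmall d L j x → SmallField W x → ∀ (φ : Site d → Fin d → Matrix n n ℂ),
      dirL1 (liftIter L j W x φ) (periodBox (L * tower L M j))
        ≤ liftConst d L j x * ((L : ℝ) ^ (d - 1)) ^ (j + 1) * ∑ y ∈ periodBox M, ∑ i : Fin d, ‖φ y i‖ := by
  induction j with
  | zero =>
      intro W x hW hx hs hWx φ
      rw [liftIter_zero hL hW hx hs hWx, pow_one]
      exact dirL1_spreadInverse_le hL hW hx _ hWx φ M
  | succ j ih =>
      intro W x hW hx hs hWx φ
      obtain ⟨hW', hx', hs', hWx'⟩ := next_level hL hW hx hs hWx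
      rw [liftIter_succ hL j hW hx hs hWx]
      have h1 := dirL1_spreadInverse_le hL hW hx (small512_of_levelSmall hL hx hs) hWx
        (liftIter L j (cavg L W) (prop1Radius d L x) φ) (L * tower L M j)
      have h2 : ∑ y ∈ periodBox (L * tower L M j), ∑ i : Fin d, ‖liftIter L j (cavg L W) (prop1Radius d L x) φ y i‖
          ≤ liftConst d L j (prop1Radius d L x) * ((L : ℝ) ^ (d - 1)) ^ (j + 1) * ∑ y ∈ periodBox M, ∑ i : Fin d, ‖φ y i‖ :=
        ih hW' hx' hs' hWx' φ
      have hC0 : 0 ≤ (1 + 128 * (d * (L : ℝ) ^ 2 * x)) * (L : ℝ) ^ (d - 1) := by positivity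
      show dirL1 _ (periodBox (L * (L * tower L M j))) ≤ _
      calc dirL1 (spreadInverse hL hW hx (small512_of_levelSmall hL hx hs) hWx (liftIter L j (cavg L W) (prop1Radius d L x) φ))
            (periodBox (L * (L * tower L M j)))
          ≤ (1 + 128 * (d * (L : ℝ) ^ 2 * x)) * (L : ℝ) ^ (d - 1)
              * ∑ y ∈ periodBox (L * tower L M j), ∑ i : Fin d, ‖liftIter L j (cavg L W) (prop1Radius d L x) φ y i‖ := h1
        _ ≤ (1 + 128 * (d * (L : ℝ) ^ 2 * x)) * (L : ℝ) ^ (d - 1)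
              * (liftConst d L j (prop1Radius d L x) * ((L : ℝ) ^ (d - 1)) ^ (j + 1) * ∑ y ∈ periodBox M, ∑ i : Fin d, ‖φ y i‖) :=
            mul_le_mul_of_nonneg_left h2 hC0
        _ = liftConst d L (j + 1) x * ((L : ℝ) ^ (d - 1)) ^ (j + 1 + 1) * ∑ y ∈ periodBox M, ∑ i : Fin d, ‖φ y i‖ := by
            simp only [liftConst, pow_succ]; ring

/-- **`ℓ²` OVER ONE PERIOD, ALL LEVELS**: the same with squares, `liftConst²` and the same volume factor `(L^{d−1})^{j+1}`. [folklore] -/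
theorem dirSq_liftIter_le (hL : 1 ≤ L) (M : ℕ) (j : ℕ) : ∀ {W : Site d → Fin d → (Matrix n n ℂ)ˣ} {x : ℝ}, IsUnitaryCfg W →
    0 ≤ x → LevelSmall d L j x → SmallField W x → ∀ (φ : Site d → Fin d → Matrix n n ℂ),
      dirSq (liftIter L j W x φ) (periodBox (L * tower L M j))
        ≤ (liftConst d L j x) ^ 2 * ((L : ℝ) ^ (d - 1)) ^ (j + 1) * ∑ y ∈ periodBox M, ∑ i : Fin d, ‖φ y i‖ ^ 2 := by
  induction j with
  | zero =>
      intro W x hW hx hs hWx φ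
      rw [liftIter_zero hL hW hx hs hWx, pow_one]
      exact dirSq_spreadInverse_le hL hW hx _ hWx φ M
  | succ j ih =>
      intro W x hW hx hs hWx φ
      obtain ⟨hW', hx', hs', hWx'⟩ := next_level hL hW hx hs hWx
      rw [liftIter_succ hL j hW hx hs hWx]
      have h1 := dirSq_spreadInverse_le hL hW hx (small512_of_levelSmall hL hx hs) hWx
        (liftIter L j (cavg L W) (prop1Radius d L x) φ) (L * tower L M j)
      have h2 : ∑ y ∈ periodBox (L * tower L M j), ∑ i : Fin d, ‖liftIter L j (cavg L W) (prop1Radius d L x) φ y i‖ ^ 2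
          ≤ liftConst d L j (prop1Radius d L x) ^ 2 * ((L : ℝ) ^ (d - 1)) ^ (j + 1) * ∑ y ∈ periodBox M, ∑ i : Fin d, ‖φ y i‖ ^ 2 :=
        ih hW' hx' hs' hWx' φ
      have hC0 : 0 ≤ (1 + 128 * (d * (L : ℝ) ^ 2 * x)) ^ 2 * (L : ℝ) ^ (d - 1) := by positivity
      show dirSq _ (periodBox (L * (L * tower L M j))) ≤ _
      calc dirSq (spreadInverse hL hW hx (small512_of_levelSmall hL hx hs) hWx (liftIter L j (cavg L W) (prop1Radius d L x) φ))
            (periodBox (L * (L * tower L M j)))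
          ≤ (1 + 128 * (d * (L : ℝ) ^ 2 * x)) ^ 2 * (L : ℝ) ^ (d - 1)
              * ∑ y ∈ periodBox (L * tower L M j), ∑ i : Fin d, ‖liftIter L j (cavg L W) (prop1Radius d L x) φ y i‖ ^ 2 := h1
        _ ≤ (1 + 128 * (d * (L : ℝ) ^ 2 * x)) ^ 2 * (L : ℝ) ^ (d - 1)
              * (liftConst d L j (prop1Radius d L x) ^ 2 * ((L : ℝ) ^ (d - 1)) ^ (j + 1)
                * ∑ y ∈ periodBox M, ∑ i : Fin d, ‖φ y i‖ ^ 2) :=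
            mul_le_mul_of_nonneg_left h2 hC0
        _ = liftConst d L (j + 1) x ^ 2 * ((L : ℝ) ^ (d - 1)) ^ (j + 1 + 1) * ∑ y ∈ periodBox M, ∑ i : Fin d, ‖φ y i‖ ^ 2 := by
            simp only [liftConst, pow_succ]; ring

end Bound

end

end Summit.QuantumFields.BalabanUV.T4Continuum.ReplicationRightInverseBound
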